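import Mathlib
import Summits.Ventures.CertifiedManyBodySolver.HubbardAlg.MbsolverRungLeaves
import Summits.Ventures.CertifiedManyBodySolver.Theses.M3PrimeEdgeSplit

/-!
# Sketch — crux-ideate on `M3PrimeEdgeSplit.LowerEdge_ge_m4o5` (stmt-Ventures-21721), team lb-sym
Idea `isotypic-thinning-by-translation-covariance` — FIRST LEMMAS only (no skeleton at this stage).

HONEST FRAMING: a certified bound is a number with a certificate; nothing here predicts
superconductivity; no summit or crux statement is proved by this file (the two `leaf_of…`/`crux_of…`
lemmas only record how ANY real lower bound ≥ -4/5 on the TL energy density closes the crux by name).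
-/

namespace Summit.Ventures.CertifiedManyBodySolver.Cruxes.LowerEdge_ge_m4o5.IsoThin

open Matrix
open Literature.MathematicalPhysics.QuantumLattice
open Literature.MathematicalPhysics.QuantumLattice.ThermodynamicLimit

/-- FIRST LEMMA of the line (1-D periodic model of the lever, scalar symbol):
for a reflection-symmetric real circulant (= translation-covariant kernel on `ℤ/N` commuting with
`x ↦ -x`), positivity on the reflection-EVEN sector alone is already positivity.
Reason: `cos(2πkx/N)` is an even eigenvector for EVERY eigenvalue `ĉ(k) = ĉ(-k)`, so the odd
(sine) sector carries no eigenvalue the even sector does not see.  The 2-D statement used by the card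
replaces `ℤ/N, {±1}` by `ℤ², D₄` and "even" by any one `D₄`-isotypic sector; for MATRIX symbols it
holds on generic momenta and, at high-symmetry momenta `k*`, only for the `Stab(k*)`-symmetrised
compression — the card's stated caveat. -/
def CirculantReflectionEvenSuffices (N : ℕ) [NeZero N] : Prop :=
  ∀ c : Fin N → ℝ, (∀ i, c (-i) = c i) →
    (∀ v : Fin N → ℝ, (∀ i, v (-i) = v i) → 0 ≤ v ⬝ᵥ (circulant c *ᵥ v)) →
      ∀ v : Fin N → ℝ, 0 ≤ v ⬝ᵥ (circulant c *ᵥ v)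

/-- The trivial (validity) direction of isotypic thinning, in the same model: dropping the odd
sector is a RELAXATION — full positivity implies even-sector positivity.  (This is all the LOWER-bound
soundness ever uses: a thinned program's certificate is a certificate of the unthinned TL problem with
the dropped Gram blocks absent, fed unchanged to `energyDensityTT'_ge_of_window_certificate_d4`.) -/
theorem even_sector_of_full {N : ℕ} [NeZero N] (c : Fin N → ℝ)
    (h : ∀ v : Fin N → ℝ, 0 ≤ v ⬝ᵥ (circulant c *ᵥ v)) :
    ∀ v : Fin N → ℝ, (∀ i, v (-i) = v i) → 0 ≤ v ⬝ᵥ (circulant c *ᵥ v) :=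
  fun v _ => h v

/-- How the line closes the crux (by name): any real `c ≥ -4/5` below the TL energy density at
`(t,t',U,n) = (1,0,8,7/8)` — e.g. `c − Σ‖aₖ‖` of an exact dual certificate of the C₂-even (E-dropped)
sub-cone of `CORE ⊕ W5d3[4]` — gives the leaf with the rational witness `-4/5`. -/
theorem leaf_of_real_lower_bound {c : ℝ} (hc : (-4/5 : ℝ) ≤ c)
    (h : c ≤ energyDensityTT' 1 0 8 (7/8)) :
    MbsolverRungLeaves.M3Lower_tp0_ge_m4o5 := by
  refine ⟨-4/5, le_rfl, ?_⟩
  unfold M3EnergyLowerRow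
  push_cast
  linarith

/-- … hence the route decl (definitionally the leaf). -/
theorem crux_of_real_lower_bound {c : ℝ} (hc : (-4/5 : ℝ) ≤ c)
    (h : c ≤ energyDensityTT' 1 0 8 (7/8)) :
    Theses.M3PrimeEdgeSplit.LowerEdge_ge_m4o5 :=
  leaf_of_real_lower_bound hc h

end Summit.Ventures.CertifiedManyBodySolver.Cruxes.LowerEdge_ge_m4o5.IsoThin
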